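import Literature.NumberTheory.EllipticCurves.CastellaGrossiLeeSkinner2022.BDPValueAtTrivialCharacter
import Literature.NumberTheory.EllipticCurves.Castella2018.PAdicWaldspurgerFormula
import HarnessLib

/-!
# Castella–Grossi–Lee–Skinner 2022: (i) the ONE-SIDED anticyclotomic main conjecture (IMC2)
# `char_Λ(𝔛_E)Λ^ur ⊇ (𝓛_E)` in `Λ^ur ⊗ ℚ_p` under `E(K)[p] = 0` (proof of Thm. 4.2.2, first half =
# Thm. 4.1.2 + Rem. 4.1.3 + Prop. 4.2.1 — NO hypothesis on `φ|_{G_p}`), and (ii) Thm. 5.1.3 (the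
# Bertolini–Darmon–Prasanna formula `𝓛_E(𝟙) = c_E⁻²(1 − a_p p⁻¹ + p⁻¹)² log_{ω_E}(P_K)²`), BOTH ON A
# FRAME `IsBDPLFunction` of the BDP `p`-adic `L`-function (the currency of Castella 2018 Thm. 3.2's fact)

Two named facts (`def … : Prop`, nothing asserted; D-0014/D-0026) from ONE published paper, typed in
the ∃-frame currency of the registered facts `Castella2018.thm32_exists_isBDPLFunction_valueAtOne`
(Cas18 Thms. 3.1–3.2, `p ∣ N`) and `castellaHsieh2018_exists_isBDPLFunction` (CH18 Def. 3.7 /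
Prop. 3.8, `p ∤ N`): "there are CM periods `Ω_K ≠ 0`, `Ω_p ∈ R₀ˣ` and `L ∈ R₀⟦T⟧ = Λ^ur` with the
interpolation property `IsBDPLFunction ι' v κ γ f Ω_K Ω_p L` AND [the printed property of `𝓛_E`]".
Both properties typed here — an `R₀⟦T⟧[1/p]`-ideal inclusion and a value at `𝟙` up to `R₀ˣ` — are
invariant under `L ↦ U·L` for a unit `U ∈ R₀⟦T⟧ˣ`, so the normalisation of the interpolation
factors (CGLS Thm. 2.1.1 vs Castella 2018 Thm. 3.1: `ξ(𝔑⁻¹)`, powers of `2` and `√D_K` absorbed in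
the periods / a binomial unit) is immaterial; any two frames of the same `(ι', v, κ, γ, f)` with
non-zero periods generate the same ideal and have the same constant term (tree theorems
`X11b.R1.span_singleton_eq_of_isBDPLFunction`, `X11b.constantCoeff_eq_of_isBDPLFunction`). Cell
`bsd-eis` (FULL-BSD rank-≤1 programme, row A1 = class X1 type A: good ANOMALOUS Eisenstein `p`),
seat `bsd-eis-ky` gen 6. Consumer: `Summits/…/Rank1Residual/X1/KellerYinIMC2HalvesPub.lean` — the
PUB-shaped inputs L-div (`GoodLatticeDivOnTree`) and L-val (`GoodBDPValueOnTree`) of Keller–Yin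
Thm. 3.0.8 at the good lattice (`thm308_of_halves`, p407283) are DISCHARGED from these two facts, so
that the preprint content of row A1 is literally ONE statement (`GoodLatticeMuLambdaOnTree`, KY
Thm. 1.5.1 + 2.2.x). The sibling `display54_thm513_generator_constantCoeff` is the composite
Thm. 4.2.2 ∘ Thm. 5.1.3 under `φ|_{G_p} ≠ 𝟙, ω` (`¬ Anom`, the EQUALITY); the present facts carry
NO condition on the isogeny characters — exactly the parts of CGLS §§4–5 whose printed hypotheses
are (h1) `E(K)[p] = 0` (resp. none).

## Citation header (read on the arXiv TeX source of v2 = the FINAL version, 2021-09-14, "to appear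
## in Invent. Math.", `Eisenstein.tex` under `run/shared/lean/b2b/bsd-rank1-residual/b2b-bsdres-lit-
## cgls/src/cgls22-v2final/` with SHA256SUMS; numbering `\thetheorem = section.subsection.n`, reset per
## subsection, intro unnumbered — lit-cgls CGLS-GV-TYPING.md "NUMBERING SETTLED")

* Authors/venue: F. Castella, G. Grossi, J. Lee, C. Skinner, *On the anticyclotomic Iwasawa theory
  of rational elliptic curves at Eisenstein primes*, Invent. Math. **227** (2022) 517–580 =
  arXiv:2008.02571v2 (`CastellaGrossiLeeSkinner2022`). REFEREED / PUBLISHED.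
* Standing setting of §3.2 = §4 (TeX L1253–L1262, L2186–L2187, verbatim): "Let `E/ℚ` be an elliptic
  curve of conductor `N`, let `p ∤ 2N` be a prime of good ordinary reduction for `E`, and let `K` be
  an imaginary quadratic field of discriminant `D_K` prime to `Np`. We assume (h1) `E(K)[p] = 0`."
  §4.1: "Let `E`, `p`, and `K` be as in §3.2, and assume in addition that hypotheses (Heeg) and
  (disc) hold." [(Heeg) = "every prime `ℓ | N` splits in `K`", Intro L241; (disc) = "`D_K` is odd
  and `D_K ≠ −3`", Intro L245–L247; (Sel) = "the `ℤ_p`-corank of `Sel_{p^∞}(E/K)` is `1`",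
  L299–L301.] `𝔛_E := H¹_{𝓕_Gr}(K, M_E)^∨` (§1.4 L857: strict at `v̄`, relaxed at `v`, `v` the
  prime induced by the fixed `ι_p`, L476–L487); `𝓛_E ∈ Λ^ur` the BDP `p`-adic `L`-function of
  Thm. 2.1.1 (L959–L1013, "by [cas-hsieh1, Prop. 3.8] the element `𝓛_E ∈ Λ^ur` … has the stated
  interpolation property"); `Λ^ur = Λ ⊗̂ ℤ_p^ur`, `Λ_ac = Λ ⊗ ℚ_p` (L944–L946, L2299).
* **Theorem 4.1.1** (`thm:howard-HPKS`, L2203–L2207): "Assume `E(K)[p] = 0`. Then there exists a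
  Kolyvagin system `κ^Hg ∈ KS(𝐓, 𝓕_Λ, 𝓛_E)` such that `κ₁^Hg ∈ H¹_{𝓕_Λ}(K, 𝐓)` is nonzero." (proof
  L2209–L2249: Howard 2004 Thm. 2.3.1 adapted to (h1) and `p ∣ h_K`; non-vanishing by Cornut–Vatsal).
* **Theorem 4.1.2** (`thm:howard-HP`, L2253–L2260, verbatim): "Assume `E(K)[p] = 0`. Then the module
  `H¹_{𝓕_Λ}(K, 𝐓)` has `Λ`-rank one, and there is a finitely generated torsion `Λ`-module `M` such
  that (i) `𝒳 ∼ Λ ⊕ M ⊕ M`, (ii) `char_Λ(M)` divides `char_Λ(H¹_{𝓕_Λ}(K, 𝐓)/Λκ₁^Hg)` in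
  `Λ[1/p, 1/(γ−1)]`. Moreover, if `H¹_𝓕(K, E[p^∞])` has `ℤ_p`-corank one, then `char_Λ(M)` divides
  `char_Λ(H¹_{𝓕_Λ}(K, 𝐓)/Λκ₁^Hg)` in `Λ[1/p]`." (= Thm. 3.4.1 + Cor. 3.4.2 applied to `κ^Hg`; the
  error terms `C₁, C₂` of §3.3 are finite for every `E` there: Lemma 3.3.3/3.3.4, L1389–L1428).
* **Remark 4.1.3** (`rem:comparison`, L2262–L2293): `κ_∞` (the `Λ`-adic class of `α`-stabilised
  Heegner points) "and `κ₁^Hg` generate the same `Λ`-submodule of `H¹_{𝓕_Λ}(K, 𝐓)`"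
  (`pr_K(κ₁^Hg) = u_K α²(β−1)²·κ₀`, `β = p/α`, display `eq:comparison`).
* **Proposition 4.2.1** (`prop:equiv-imc`, L2303–L2330, verbatim): "Assume that `p = v v̄` splits in
  `K` and that `E(K)[p] = 0`. Then the following statements are equivalent: (i) Both `H¹_{𝓕_Λ}(K, 𝐓)`
  and `𝒳 = H¹_{𝓕_Λ}(K, M_E)^∨` have `Λ`-rank one, and the divisibility `char_Λ(𝒳_tors) ⊃
  char_Λ(H¹_{𝓕_Λ}(K, 𝐓)/Λκ_∞)²` holds in `Λ_ac`. (ii) Both `H¹_{𝓕_Gr}(K, 𝐓)` and `𝔛_E =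
  H¹_{𝓕_Gr}(K, M_E)^∨` are `Λ`-torsion, and the divisibility `char_Λ(𝔛_E)Λ^ur ⊃ (𝓛_E)` holds in
  `Λ^ur ⊗_{ℤ_p} ℚ_p`. Moreover, the same result holds for the opposite divisibilities." (proof: "See
  [BCK, Thm. 5.2], whose proof still applies after inverting `p`" = Burungale–Castella–Kim 2021.)
* **Proof of Theorem 4.2.2, first half** (L2343–L2352, verbatim): "By Theorem 4.1.2, the modules
  `H¹_{𝓕_Λ}(K, 𝐓)` and `H¹_{𝓕_Λ}(K, M_E)^∨` have both `Λ`-rank one, with `char_Λ(H¹_{𝓕_Λ}(K,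
  M_E)^∨_tors) ⊃ char_Λ(H¹_{𝓕_Λ}(K, 𝐓)/Λκ₁^Hg)²` as ideals in `Λ_ac = Λ[1/p]`. Since by Remark 4.1.3
  the classes `κ₁^Hg` and `κ_∞` generate the same `Λ`-submodule of `H¹_{𝓕_Λ}(K, 𝐓)`, by
  Proposition 4.2.1 it follows that `𝔛_E` is `Λ`-torsion, with `char_Λ(𝔛_E)Λ^ur ⊃ (𝓛_E)` as ideals
  in `Λ_ac ⊗̂_{ℤ_p} ℤ_p^ur`." — the hypothesis `φ|_{G_p} ≠ 𝟙, ω` of Thm. 4.2.2 enters only in the NEXT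
  sentence ("This divisibility, together with the equalities `μ(𝔛_E) = μ(𝓛_E) = 0` and `λ(𝔛_E) =
  λ(𝓛_E)` in Theorem 2.2.3, yields the result") and, upstream, only to secure (h1) ("The hypotheses
  on `φ` imply that `E(K)[p] = 0`", proof of Thm. 5.3.1, L2630). So the displayed one-sided
  statement is PROVED in print under: §3.2/§4.1 standing + (Heeg) + (disc) + (spl) + (h1) + (Sel)
  [(Sel) for the "Moreover" clause of Thm. 4.1.2, which puts the divisibility in `Λ[1/p]` as
  Prop. 4.2.1 (i) requires].
* **Theorem 5.1.3** (`thmpadicGZ`, L2463–L2471) with the data of §5.1.2 (L2434–L2447), verbatim: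
  "Let `E/ℚ` be an elliptic curve of conductor `N`, and fix a parametrization `π : X₀(N) → E`. Let
  `K` be an imaginary quadratic field satisfying the Heegner hypothesis relative to `N`, and fix an
  integral ideal `𝔑 ⊂ 𝓞_K` with `𝓞_K/𝔑 = ℤ/Nℤ`. Let `x₁ = [ℂ/𝓞_K → ℂ/𝔑⁻¹] ∈ X₀(N)` be the Heegner
  point of conductor `1` …, and set `P_K = Σ_{σ ∈ Gal(H/K)} π(x₁)^σ ∈ E(K)`. … Let also `ω_E` be a
  Néron differential on `E`, and let `c_E ∈ ℤ` be the associated Manin constant, so that `π^*(ω_E) =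
  c_E · ω_f`." — "Under the above hypotheses, let `p > 2` be a prime of good reduction for `E` such
  that `p = v v̄` splits in `K`. Then `𝓛_E(0) = c_E⁻² · (1 − a_p p⁻¹ + p⁻¹)² · log_{ω_E}(P_K)²`, where
  `log_{ω_E} : E(K_v) → K_v` is the formal group logarithm associated to `ω_E`." Proof (L2474–L2481):
  "[BDP, Thm. 5.13] specialized to `k = 2`, `r = j = 0`, `χ = N_K⁻¹`" and `log_{ω_f}(Δ₁) = c_E⁻¹ ·
  log_{ω_E}(π(Δ₁))`. NO hypothesis on `ρ̄_{E,p}`, on `D_K` beyond (Heeg), or on (Sel).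

## Transcription (tree vocabulary only; every symbol a Literature object)

* `E/ℚ` of conductor `N`, `p ∤ 2N` good, "Eisenstein prime" (the paper's global standing
  assumption, Intro L195: `E[p]` reducible; good ordinary then follows by Fontaine — tree
  `goodOrd_of_red_of_good`): a globally minimal `W` (so `a_p = W.frobeniusTrace p` and `ω = dx/(2y +
  a₁x + a₃)` IS a Néron differential), `f` its newform of level `N` (`IsNewformOf W f`; in (ii) the
  parametrisation datum `Dt : ModularParametrizationData W N`, `Dt.c` = the Manin constant `c_E`,
  `ModularCurve.lean`), `p ≠ 2`, `¬ p ∣ N`, and in (i) `Red W p`.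
* `K`: `IsImaginaryQuadratic K`; (Heeg) `SatisfiesHeegnerHypothesis N K`; (spl) "`p = v v̄` splits":
  `((Ideal.span {(p : ℤ)}).primesOver (𝓞 K)).ncard = 2`; (disc) `Odd (discr K) ∧ discr K ≠ -3`;
  (h1) `∀ Q ∈ E(K), p • Q = 0 → Q = 0`; (Sel) `(W.baseChange K).selmerCorank p = 1`.
* `v` = the prime of `ι_p`: the embedding datum `ι' : ℚ̄_p ≃ ℂ` (CGLS's `ι_∞ ∘ ι_p⁻¹`) with the
  compatibility clause `k ∈ v ↔ ‖ι'⁻¹(w.embedding k)‖_p < 1` of the sibling facts (the infinite place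
  read through Mathlib's embedding, as `IsBDPLFunction` reads infinity types); `v̄` = the OTHER prime
  above `p` (`p ∈ v̄`, `v̄ ≠ v`); `𝔛_E = AcSelmer.XAc (W.baseChange K) p κ vbar ∅ γ` (strict at `v̄`,
  relaxed at `v`) and `Λ = IwasawaAlgebra p` EXACTLY as in `thm511_anticyclotomicControl` /
  `display54_thm513_generator_constantCoeff`; `κ` THE anticyclotomic `ℤ_p`-extension, `γ` a
  topological generator (`1 + T ↔ γ`).
* `𝓛_E` with its interpolation property: a frame `(Ω_K ≠ 0, Ω_p ∈ R₀ˣ, L ∈ R₀⟦T⟧)` with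
  `IsBDPLFunction ι' v κ γ f Ω_K Ω_p L` (`BDPAnticyclotomicPAdicLFunction.lean`), quantified
  existentially as in the sibling facts.
* (i) "`char_Λ(𝔛_E)Λ^ur ⊃ (𝓛_E)` in `Λ^ur ⊗ ℚ_p`": `∃ k, p^k · L ∈ char_Λ(𝔛_E) · R₀⟦T⟧`, the
  extension of ideals along `Λ = ℤ_p⟦T⟧ → R₀⟦T⟧` induced by THE structure map `j : ℤ_p → R₀`
  (characterised by `j(x) = x` in `ℂ_p`; the tree's `X11b.Halves.toUnr` is Summits-side, so the map
  is a universally quantified binder with its characterisation).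
* (ii) "`𝓛_E(0) = c_E⁻²(1 − a_p p⁻¹ + p⁻¹)² log_{ω_E}(P_K)²`", `log_{ω_E} : E(K_v) → K_v = ℚ_p`: the
  value of `L` at `T = 0` (`UnrSeries.HasValueAt L 0`, = the constant term) is `u · c_E⁻² (1 − a_p
  p⁻¹ + p⁻¹)² (padicLogOmega W p e P)²` with `u ∈ R₀ˣ` (the unit absorbs the frame normalisation;
  WEAKER than the printed equality, hence implied by it), where `e : K →+* ℚ_p` induces `v`
  (`k ∈ v ↔ ‖e k‖ < 1`), `P ∈ E(K)` with `w.embedding(P) = heegnerPointComplex Dt H = P_K`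
  (`HeegnerPoints.lean`; the complex embedding is THE infinite place's, through which the frame reads
  infinity types — Cas18 Thm. 3.2's fact verbatim), and `padicLogOmega W p e P = log_W(z(m₀ •
  P_e))/m₀` (`PAdicWaldspurgerFormula.lean`; same body as CGLS's reading in
  `display54_thm513_generator_constantCoeff`).

## Contents
* `proofThm422_exists_isBDPLFunction_isTorsion_charIdeal_dvd` — fact (i).
* `thm513_exists_isBDPLFunction_valueAtOne` — fact (ii).

## References
* [CastellaGrossiLeeSkinner2022] Thm. 4.1.1 (L2203–L2249), Thm. 4.1.2 (L2253–L2260), Rem. 4.1.3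
  (L2262–L2293), Prop. 4.2.1 (L2303–L2330), proof of Thm. 4.2.2 (L2343–L2357), §5.1.2 + Thm. 5.1.3
  (L2432–L2481), Thm. 2.1.1 (L959–L1013), §3.2 standing (L1253–L1262).
* [BurungaleCastellaKim2021] Thm. 5.2 (the source of Prop. 4.2.1); [Howard2004] Thms. 2.2.10, 2.3.1;
  [BertoliniDarmonPrasanna2013] Thm. 5.13 (the source of Thm. 5.1.3); [CastellaHsieh2018] Prop. 3.8.
* Tree: `BDPValueAtTrivialCharacter.lean` (display54, the `¬ Anom` EQUALITY twin), `Castella2018/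
  PAdicWaldspurgerFormula.lean` (Cas18 Thm. 3.2, the `p ∣ N` twin of (ii)), `CastellaHsieh2018/
  BDPLFunctionExistence.lean` (existence at good `p`).
-/

set_option autoImplicit false

noncomputable section

open scoped Classical

open PowerSeries WeierstrassCurve NumberField IsDedekindDomain Field
  Literature.NumberTheory.EllipticCurves Literature.NumberTheory.EllipticCurves.ModularForms
  Literature.NumberTheory.QuadraticFields Literature.NumberTheory.EllipticCurves.Rank1Residual
  Literature.NumberTheory.EllipticCurves.Castella2018

namespace Literature.NumberTheory.EllipticCurves.CastellaGrossiLeeSkinner2022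

/-- **Castella–Grossi–Lee–Skinner 2022, proof of Thm. 4.2.2 (first half) = Thm. 4.1.2 + Rem. 4.1.3
+ Prop. 4.2.1, as the printed proof composes them** (arXiv:2008.02571v2 = Invent. Math. 227, TeX
L2343–L2352, verbatim): "By Theorem 4.1.2, the modules `H¹_{𝓕_Λ}(K, 𝐓)` and `H¹_{𝓕_Λ}(K, M_E)^∨`
have both `Λ`-rank one, with `char_Λ(H¹_{𝓕_Λ}(K, M_E)^∨_tors) ⊃ char_Λ(H¹_{𝓕_Λ}(K, 𝐓)/Λκ₁^Hg)²` as
ideals in `Λ_ac = Λ[1/p]`. Since by Remark 4.1.3 the classes `κ₁^Hg` and `κ_∞` generate the same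
`Λ`-submodule …, by Proposition 4.2.1 it follows that `𝔛_E` is `Λ`-torsion, with
`char_Λ(𝔛_E)Λ^ur ⊃ (𝓛_E)` as ideals in `Λ_ac ⊗̂_{ℤ_p} ℤ_p^ur`." Printed hypotheses of the three
inputs: §3.2/§4.1 standing ("`E/ℚ` of conductor `N`, `p ∤ 2N` a prime of good ordinary reduction,
`K` imaginary quadratic of discriminant prime to `Np`, (h1) `E(K)[p] = 0`", "(Heeg) and (disc)
hold"), Thm. 4.1.2 "Assume `E(K)[p] = 0`" with its "Moreover" clause under "`H¹_𝓕(K, E[p^∞])` has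
`ℤ_p`-corank one" (= (Sel)), Prop. 4.2.1 "`p = v v̄` splits in `K` and `E(K)[p] = 0`". NO hypothesis
on the isogeny characters (`φ|_{G_p} ≠ 𝟙, ω` enters Thm. 4.2.2 only through Thm. 2.2.3 in the next
sentence), so the ANOMALOUS case is covered verbatim. TRANSCRIBED (module docstring for the
dictionary): `W` globally minimal, `f` its newform of level `N`, `p ≠ 2`, `p ∤ N`, `Red W p` (the
paper's Eisenstein setting; ordinary follows); `K` imaginary quadratic with (Heeg) for `N`, (spl),
(disc), (h1), (Sel); `v` induced by the embedding datum `ι'`, `v̄ ∋ p` the other prime, `κ`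
anticyclotomic with topological generator `γ`, `𝔛_E = AcSelmer.XAc (W.baseChange K) p κ vbar ∅ γ`;
conclusion: there are CM periods `Ω_K ≠ 0`, `Ω_p ∈ R₀ˣ` and `L ∈ R₀⟦T⟧` with `IsBDPLFunction ι' v κ γ
f Ω_K Ω_p L` (Thm. 2.1.1 = [CH18, Prop. 3.8]) such that `𝔛_E` is `Λ`-torsion and, along THE
structure map `j : ℤ_p → R₀` (`j(x) = x` in `ℂ_p`), `p^k · L ∈ char_Λ(𝔛_E)·R₀⟦T⟧` for some `k`.
Invariant under `L ↦ U·L`, `U ∈ R₀⟦T⟧ˣ`. PUBLISHED; nothing asserted.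
[cite: CastellaGrossiLeeSkinner2022, proof of Thm. 4.2.2 (TeX L2343–L2352) composing Thm. 4.1.2 (`thm:howard-HP`, L2253–L2260), Rem. 4.1.3 (`rem:comparison`) and Prop. 4.2.1 (`prop:equiv-imc`, L2303–L2330); Thm. 4.1.1 (L2203–L2207); §3.2 standing hypotheses (L1253–L1262)]
[cite: BurungaleCastellaKim2021, Thm. 5.2 (the source of Prop. 4.2.1)]
[cite: CastellaHsieh2018, Prop. 3.8 (the construction of `𝓛_E`, CGLS Thm. 2.1.1)] -/
def proofThm422_exists_isBDPLFunction_isTorsion_charIdeal_dvd : Prop :=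
  ∀ {p : ℕ} [Fact p.Prime] (ι' : PadicAlgCl p ≃+* ℂ) (W : WeierstrassCurve ℚ) [W.IsElliptic]
    [W.IsGloballyMinimal] (K : Type) [Field K] [NumberField K] (v vbar : HeightOneSpectrum (𝓞 K))
    (κ : ZpExtension K p) (γ : absoluteGaloisGroup K) [Fact (κ.IsTopGenerator γ)] {N : ℕ} [NeZero N]
    {f : CuspForm (CongruenceSubgroup.Gamma0 N) 2} (_ : IsNewformOf W f),
    p ≠ 2 → ¬ p ∣ N → Red W p →
    IsImaginaryQuadratic K → SatisfiesHeegnerHypothesis N K →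
      ((Ideal.span {(p : ℤ)}).primesOver (𝓞 K)).ncard = 2 →
      Odd (NumberField.discr K) → NumberField.discr K ≠ -3 →
      (∀ Q : (W.baseChange K).toAffine.Point, p • Q = 0 → Q = 0) →
      (W.baseChange K).selmerCorank p = 1 →
    (∀ (w : InfinitePlace K) (k : 𝓞 K), k ∈ v.asIdeal ↔ ‖ι'.symm (w.embedding (k : K))‖ < 1) →
      ((p : ℕ) : 𝓞 K) ∈ vbar.asIdeal → vbar ≠ v →
    κ.IsAnticyclotomic →
    ∃ (ΩK : ℂ) (Ωp : (unrIntegers p)ˣ) (L : UnrSeries p),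
      ΩK ≠ 0 ∧ IsBDPLFunction ι' v κ γ f ΩK ((Ωp : unrIntegers p) : ℂ_[p]) L ∧
      Module.IsTorsion (IwasawaAlgebra p) (AcSelmer.XAc (W.baseChange K) p κ vbar ∅ γ) ∧
      ∀ (j : ℤ_[p] →+* unrIntegers p),
        (∀ x : ℤ_[p], ((j x : unrIntegers p) : ℂ_[p]) = algebraMap ℚ_[p] ℂ_[p] (x : ℚ_[p])) →
        ∃ k : ℕ, C ((p : unrIntegers p) ^ k) * L ∈
          (AcSelmer.XAc.charIdeal (W.baseChange K) p κ vbar ∅ γ).map (PowerSeries.map j)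

/-- **Castella–Grossi–Lee–Skinner 2022, Theorem 5.1.3 (the Bertolini–Darmon–Prasanna formula at
the trivial character) on a frame of `𝓛_E`** (arXiv:2008.02571v2 = Invent. Math. 227, TeX
`thmpadicGZ` L2463–L2471 with the data of §5.1.2 L2434–L2447, verbatim): "Let `E/ℚ` be an elliptic
curve of conductor `N`, and fix a parametrization `π : X₀(N) → E`. Let `K` be an imaginary quadratic
field satisfying the Heegner hypothesis relative to `N`, and fix an integral ideal `𝔑 ⊂ 𝓞_K` with
`𝓞_K/𝔑 = ℤ/Nℤ` … `P_K = Σ_{σ ∈ Gal(H/K)} π(x₁)^σ ∈ E(K)` … `ω_E` a Néron differential on `E`, `c_E ∈ ℤ`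
the associated Manin constant, so that `π^*(ω_E) = c_E · ω_f`." — "Under the above hypotheses, let
`p > 2` be a prime of good reduction for `E` such that `p = v v̄` splits in `K`. Then `𝓛_E(0) = c_E⁻²
· (1 − a_p p⁻¹ + p⁻¹)² · log_{ω_E}(P_K)²`, where `log_{ω_E} : E(K_v) → K_v` is the formal group
logarithm associated to `ω_E`." (Proof: BDP 2013 Thm. 5.13 at `k = 2`, `r = j = 0`, `χ = N_K⁻¹`, and
`log_{ω_f}(Δ₁) = c_E⁻¹ log_{ω_E}(π(Δ₁))`.) NO hypothesis on `ρ̄_{E,p}` or on the isogeny characters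
(the anomalous Euler factor `(1 − a_p + p)/p` is just a `p`-adic number). SCOPE FLAG `CGLS22-Thm513-disc`
(ARM P cited-input audit, cell pub/bsd-cited, queue row Q12; reader bsd-cited-r08, sheet
AUDIT-BDP13CH18-r08-e02bb94a §F1, sha16 e02bb94ab7764dc2; typer bsd-cited-ty3, 2026-08-26; STATEMENT BELOW
UNCHANGED): the earlier sentence here «none on `D_K` beyond the Heegner hypothesis» was STRONGER THAN PRINT —
the object `𝓛_E` of Thm. 5.1.3 is the one of Thm. 2.1.1, defined under CGLS §2's standing hypotheses «(Heeg),
(spl), and (disc)» (TeX L935; (disc) = `D_K` odd and `D_K ≠ −3`, Introduction), and its printed source BDP 2013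
Thm. 5.13 is stated under Assumption 5.12 (3) «K has odd discriminant and satisfies the Heegner hypothesis»;
§5.1.2 itself says only «satisfying the Heegner hypothesis relative to N». So the declaration below, which
quantifies over EVERY imaginary quadratic `K` with (Heeg) + (spl), is STRONGER-THAN-PRINT at `K` with even `D_K`
or `D_K = −3`, and faithful (weaker: value up to a unit) elsewhere. The corrected twin is
`thm513_exists_isBDPLFunction_valueAtOne_disc` below (the two (disc) binders `Odd (discr K)`, `discr K ≠ −3`
inserted after (Heeg); bridge `…_disc_of_thm513`: this declaration implies the twin). Every partition-side
consumer already carries (disc) (X1 `goodBDPValueOnTree_of_cgls` receives `_hodd _h3`; the display-(5.4)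
facts bind (disc)), so 0 classes are affected; consumers without (disc) in scope (X6 / X11b files, via the
Cas18 Thm. 3.2 twin at `p ∣ N`) are their cells' to re-point. TRANSCRIBED (module docstring for the dictionary): `W` globally minimal (`a_p =
W.frobeniusTrace p`, `ω` Néron), `Dt : ModularParametrizationData W N` (`Dt.f` the newform, `Dt.c =
c_E`), `H : HeegnerDatum N (discr K)` (the ideal `𝔑`), `P ∈ E(K)` with `w.embedding(P) =
heegnerPointComplex Dt H = P_K` for THE infinite place `w` (as in Cas18 Thm. 3.2's fact), `p ≠ 2`,
`p ∤ N`, `K` imaginary quadratic, `p` split, (Heeg) for `N`, `v ∋ p` induced by the embedding datum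
`ι'`, `e : K →+* ℚ_p` inducing `v` (`log_{ω_E}` at `v`: `padicLogOmega W p e P`), `κ` anticyclotomic
with topological generator `γ`; conclusion: there are `Ω_K ≠ 0`, `Ω_p ∈ R₀ˣ`, `L ∈ R₀⟦T⟧` with
`IsBDPLFunction ι' v κ γ Dt.f Ω_K Ω_p L` (Thm. 2.1.1) and `u ∈ R₀ˣ` with `L(𝟙) = u · c_E⁻² (1 − a_p
p⁻¹ + p⁻¹)² (log_{ω_E} P_K)²` — the value up to a unit of `R₀` (absorbing the frame's normalisation)
is WEAKER than the printed equality, hence implied by it. PUBLISHED; nothing asserted.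
[cite: CastellaGrossiLeeSkinner2022, Thm. 5.1.3 (TeX `thmpadicGZ`, L2463–L2471) with §5.1.2 (L2434–L2447) and its proof (L2474–L2481); Thm. 2.1.1 (L959–L1013)]
[cite: BertoliniDarmonPrasanna2013, Thm. 5.13 (the source of Thm. 5.1.3)]
[cite: Castella2018, Thm. 3.2 (arXiv:1704.06608 p. 9) (the `p ∣ N` twin, same currency)] -/
def thm513_exists_isBDPLFunction_valueAtOne : Prop :=
  ∀ {p : ℕ} [Fact p.Prime] (ι' : PadicAlgCl p ≃+* ℂ) (W : WeierstrassCurve ℚ) [W.IsElliptic]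
    [W.IsGloballyMinimal] (K : Type) [Field K] [NumberField K] (v : HeightOneSpectrum (𝓞 K))
    (κ : ZpExtension K p) (γ : absoluteGaloisGroup K) {N : ℕ} [NeZero N]
    (Dt : ModularParametrizationData W N) (H : HeegnerDatum N (NumberField.discr K))
    (w : InfinitePlace K) (e : K →+* ℚ_[p]) (P : (W.baseChange K).toAffine.Point),
    p ≠ 2 → ¬ p ∣ N →
    IsImaginaryQuadratic K → ((Ideal.span {(p : ℤ)}).primesOver (𝓞 K)).ncard = 2 →
    ((p : ℕ) : 𝓞 K) ∈ v.asIdeal →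
    (∀ (w' : InfinitePlace K) (k : 𝓞 K), k ∈ v.asIdeal ↔ ‖ι'.symm (w'.embedding (k : K))‖ < 1) →
    SatisfiesHeegnerHypothesis N K →
    κ.IsAnticyclotomic → κ.IsTopGenerator γ →
    WeierstrassCurve.Affine.Point.map w.embedding.toRatAlgHom P = heegnerPointComplex Dt H →
    (∀ k : 𝓞 K, k ∈ v.asIdeal ↔ ‖e (k : K)‖ < 1) →
    ∃ (ΩK : ℂ) (Ωp : (unrIntegers p)ˣ) (L : UnrSeries p),
      ΩK ≠ 0 ∧ IsBDPLFunction ι' v κ γ Dt.f ΩK ((Ωp : unrIntegers p) : ℂ_[p]) L ∧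
      ∃ u : (unrIntegers p)ˣ, L.HasValueAt 0
        (((u : unrIntegers p) : ℂ_[p]) *
          algebraMap ℚ_[p] ℂ_[p] (((Dt.c : ℚ_[p])⁻¹) ^ 2 *
            (1 - (W.frobeniusTrace p : ℚ_[p]) * (p : ℚ_[p])⁻¹ + (p : ℚ_[p])⁻¹) ^ 2 *
            (padicLogOmega W p e P) ^ 2))

/-! ## CORRECTED TWIN with CGLS §2's (disc) (ARM P typer bsd-cited-ty3, 2026-08-26; reader of record bsd-cited-r08,
## sheet AUDIT-BDP13CH18-r08-e02bb94a §F1; scope flag `CGLS22-Thm513-disc` on the declaration above) -/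

/-- **Castella–Grossi–Lee–Skinner 2022, Theorem 5.1.3 on a frame of `𝓛_E`, WITH the standing hypothesis
(disc) of CGLS §2** — the corrected twin of `thm513_exists_isBDPLFunction_valueAtOne`: binder-for-binder the
same statement (same order) with the two (disc) binders `Odd (NumberField.discr K)` and
`NumberField.discr K ≠ -3` inserted after `SatisfiesHeegnerHypothesis N K`. Print: Thm. 5.1.3 (TeX
`thmpadicGZ` L2463–L2471) "Under the above hypotheses, let `p > 2` be a prime of good reduction for `E` such
that `p = v v̄` splits in `K`. Then `𝓛_E(0) = c_E⁻² · (1 − a_p p⁻¹ + p⁻¹)² · log_{ω_E}(P_K)²`", where `𝓛_E` is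
the element of Thm. 2.1.1 (L959), constructed in §2 under "K an imaginary quadratic field satisfying
hypotheses (Heeg), (spl), and (disc) from the introduction" (L935; (disc): `D_K` odd and `D_K ≠ −3`), from
Bertolini–Darmon–Prasanna 2013 Thm. 5.13, itself under their Assumption 5.12 (3) "The quadratic imaginary field
`K` has odd discriminant and satisfies the Heegner hypothesis" (BDP Rem. 4.7: "The restriction that `c` and
`d_K` are odd is made for convenience to simplify the local calculations"). Transcription, dictionary and
conclusion (value at `𝟙` up to a unit of `R₀`, WEAKER than the printed equality) exactly as in the declaration
above. PUBLISHED; named fact, nothing asserted, no `_holds`; implied by the (stronger-than-print) declaration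
above (`thm513_exists_isBDPLFunction_valueAtOne_disc_of_thm513`).
[cite: CastellaGrossiLeeSkinner2022, Thm. 5.1.3 (TeX `thmpadicGZ`, L2463–L2471) with §5.1.2 (L2434–L2447), Thm. 2.1.1 (L959–L1013) and the standing hypotheses of §2 (L935: (Heeg), (spl), (disc))]
[cite: BertoliniDarmonPrasanna2013, Thm. 5.13 with Assumption 5.12 (3) and Rem. 4.7] -/
def thm513_exists_isBDPLFunction_valueAtOne_disc : Prop :=
  ∀ {p : ℕ} [Fact p.Prime] (ι' : PadicAlgCl p ≃+* ℂ) (W : WeierstrassCurve ℚ) [W.IsElliptic]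
    [W.IsGloballyMinimal] (K : Type) [Field K] [NumberField K] (v : HeightOneSpectrum (𝓞 K))
    (κ : ZpExtension K p) (γ : absoluteGaloisGroup K) {N : ℕ} [NeZero N]
    (Dt : ModularParametrizationData W N) (H : HeegnerDatum N (NumberField.discr K))
    (w : InfinitePlace K) (e : K →+* ℚ_[p]) (P : (W.baseChange K).toAffine.Point),
    p ≠ 2 → ¬ p ∣ N →
    IsImaginaryQuadratic K → ((Ideal.span {(p : ℤ)}).primesOver (𝓞 K)).ncard = 2 →
    ((p : ℕ) : 𝓞 K) ∈ v.asIdeal →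
    (∀ (w' : InfinitePlace K) (k : 𝓞 K), k ∈ v.asIdeal ↔ ‖ι'.symm (w'.embedding (k : K))‖ < 1) →
    SatisfiesHeegnerHypothesis N K →
    -- (disc) of CGLS §2 (TeX L935) = BDP 2013 Assumption 5.12 (3): `D_K` odd and `D_K ≠ −3`
    Odd (NumberField.discr K) → NumberField.discr K ≠ -3 →
    κ.IsAnticyclotomic → κ.IsTopGenerator γ →
    WeierstrassCurve.Affine.Point.map w.embedding.toRatAlgHom P = heegnerPointComplex Dt H →
    (∀ k : 𝓞 K, k ∈ v.asIdeal ↔ ‖e (k : K)‖ < 1) →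
    ∃ (ΩK : ℂ) (Ωp : (unrIntegers p)ˣ) (L : UnrSeries p),
      ΩK ≠ 0 ∧ IsBDPLFunction ι' v κ γ Dt.f ΩK ((Ωp : unrIntegers p) : ℂ_[p]) L ∧
      ∃ u : (unrIntegers p)ˣ, L.HasValueAt 0
        (((u : unrIntegers p) : ℂ_[p]) *
          algebraMap ℚ_[p] ℂ_[p] (((Dt.c : ℚ_[p])⁻¹) ^ 2 *
            (1 - (W.frobeniusTrace p : ℚ_[p]) * (p : ℚ_[p])⁻¹ + (p : ℚ_[p])⁻¹) ^ 2 *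
            (padicLogOmega W p e P) ^ 2))

/-- **Bridge `old → new`**: the declaration of record `thm513_exists_isBDPLFunction_valueAtOne` (no (disc)
binder — stronger than print) implies the corrected twin with (disc); the two extra hypotheses are simply
not used. [cite: CastellaGrossiLeeSkinner2022, Thm. 5.1.3 (TeX `thmpadicGZ`, L2463–L2471)] -/
theorem thm513_exists_isBDPLFunction_valueAtOne_disc_of_thm513
    (h : thm513_exists_isBDPLFunction_valueAtOne) : thm513_exists_isBDPLFunction_valueAtOne_disc :=
  fun ι' W _ _ K _ _ v κ γ _ _ Dt H w e P hp hpN hK hspl hv hvι hHeeg _ _ hκ hγ hP he =>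
    h ι' W K v κ γ Dt H w e P hp hpN hK hspl hv hvι hHeeg hκ hγ hP he

end Literature.NumberTheory.EllipticCurves.CastellaGrossiLeeSkinner2022

end
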